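import Mathlib
import HarnessLib
import Summits.ResolutionOfSingularities.ResolutionOfSingularities.Theorems.WildQuotientsWildQuotientResolutionS1aCuspPointsFamily
import Summits.ResolutionOfSingularities.ResolutionOfSingularities.Theorems.WildQuotientsWildQuotientResolutionS1aCuspPointFacts
import Summits.ResolutionOfSingularities.ResolutionOfSingularities.Theorems.WildQuotientsWildQuotientResolutionS1aCuspRingDataFamily
import Summits.ResolutionOfSingularities.ResolutionOfSingularities.Theorems.WildQuotientsWildQuotientResolutionS1aCuspMemberOXi
import Summits.ResolutionOfSingularities.ResolutionOfSingularities.Theorems.WildQuotientsWildQuotientResolutionS1aCuspMemberQ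
import Summits.ResolutionOfSingularities.ResolutionOfSingularities.Theorems.WildQuotientsWildQuotientResolutionS1aCuspMemberQv
import Summits.ResolutionOfSingularities.ResolutionOfSingularities.Theorems.WildQuotientsWildQuotientResolutionS1aSectionGlueKillAssoc
import Summits.ResolutionOfSingularities.ResolutionOfSingularities.Theorems.WildQuotientsWildQuotientResolutionS1aGraphTailKillsIn
import Summits.ResolutionOfSingularities.ResolutionOfSingularities.Theorems.WildQuotientsWildQuotientResolutionS1aQhTailSection
import Summits.ResolutionOfSingularities.ResolutionOfSingularities.Theorems.WildQuotientsWildQuotientResolutionS1aCuspFLocus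

/-!
# S1a — R4c cusp: SKELETON DRAFT v2 of the assembly `cusp_killsIn_two` (MOVE 1 real; MOVE 2: transition sections, global sections,
# the THREE MEMBER CHARTS real; the final glue-and-kill step = `sorry`)

[OURS · L1 W4.5c · crux stmt-ResolutionOfSingularities-17941 `CyclicQuotientFourfolds`, line `s1a-logminvertex` v13 (`stub_reachLowerInFX`); R4c (b6);
v1 leafhand-res-wildquotients-1 g0 (2026-08-30), v2 leafhand-res-wildquotients-2 g0 (2026-08-31)] — NOT statements of the manuscript; counted 0;
a crux WORKFILE (sorry allowed), NOT a Theorems file.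

v2 adds, all kernel-checked (farm rc 0, 1 sorry, ≈130 s): the chart-cover / transition-section block of ✓`graphTail_killsIn_two` ported to the cusp tables
(`hWle₁`, killed charts `(i,0)` via `hunit0`/`hz0W`, `hπ'`, `hJ'`, `hxJ`, `hcovM`, `tr/htrE/htrU`); the global sections `x₀`, `ξ_O = 2x₂ − 3x₁²`,
`f = x₂² − x₁³`, their `γ_Q`-images (`γ_Q ξ_O = ξ_Q = 2x₂ + 2(1−3a)x₁ − 3x₁²`, `γ_Q f = T_Q`, by `2c = 3a²`, `c² = a³`) and the `E`-values of their
pull-backs on every producer chart (`hEval`, `hr0`, `hrxi`, `hrt`); and the THREE MEMBER CHARTS instantiated from the tree: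
✓`exists_cuspO_memberChart_rel_xi` on `O′₀₁` (`U_O`, sections `aO, bbO`), ✓`exists_cuspQ_memberChart_rel` on `O′₁₁` (`U_{Q,1}`),
✓`exists_cuspQv_memberChart_rel` on `O′₁₂` (`U_{Q,2}`, cover element `u₂′^(p·9D)` from `cusp_ringData`'s `hc2` at `i = 1`).
Remaining (the one `sorry`): common degree `dO·dQ·dQv`, `hass` by ✓`associated_sections_of_mul_pow_eq_global` (relations `hrela*/hrelb*` + `happ`),
and ✓`killsIn_one_of_sectionCharts_of_associated` with cover `Uc = {O′ᵢⱼ ∩ D(z₀)} ∪ {O′ᵢⱼ ∩ D(z₁)} ∪ {π⁻¹D(x₀)}` — its three obligations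
(COVER incl. residual points ⊆ members, UNITS, F-LOCUS) are spelled out in `Lines/s1a_logminvertex-R4c-PROGRESS-v2.md`; a direct term for this step
with dependent `Fin.cases` families did not elaborate within 600 s (farm rc 124) — package the three members as ONE `Fin 3` family lemma first.
Recipe: `Lines/s1a_logminvertex-R4c-PROGRESS-b3Q.md` ADDENDUM 2.
-/

set_option linter.dupNamespace false

noncomputable section

open CategoryTheory Limits AlgebraicGeometry TopologicalSpace Topology Opposite MvPolynomial
open Literature.AlgebraicGeometry.Resolution Literature.AlgebraicGeometry.RelativeSpec
open scoped LaurentPolynomial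
open Summit.ResolutionOfSingularities.ResolutionOfSingularities.Theorems.WildQuotientResolution.S1 Summit.ResolutionOfSingularities.ResolutionOfSingularities.Theorems.WildQuotientResolution.S1.NodeAtlas Summit.ResolutionOfSingularities.ResolutionOfSingularities.Theorems.WildQuotientResolution.S1.CoarseChart Summit.ResolutionOfSingularities.ResolutionOfSingularities.Theorems.WildQuotientResolution.S1.ProducerStep
open Summit.ResolutionOfSingularities.ResolutionOfSingularities.Theorems.WildQuotientResolution.S1.NpFrame Summit.ResolutionOfSingularities.ResolutionOfSingularities.Theorems.WildQuotientResolution.S1.GoodCharts Summit.ResolutionOfSingularities.ResolutionOfSingularities.Theorems.WildQuotientResolution.S1.BlowupCharts Summit.ResolutionOfSingularities.ResolutionOfSingularities.Theorems.WildQuotientResolution.S1.KillableTransport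
open Summit.ResolutionOfSingularities.ResolutionOfSingularities.Theorems.WildQuotientResolution.S1.KillCert Summit.ResolutionOfSingularities.ResolutionOfSingularities.Theorems.WildQuotientResolution.S1.ReesBigrading Summit.ResolutionOfSingularities.ResolutionOfSingularities.Theorems.WildQuotientResolution.S1.NodeTransport Summit.ResolutionOfSingularities.ResolutionOfSingularities.Theorems.WildQuotientResolution.S1.CobordantTransport
open Summit.ResolutionOfSingularities.ResolutionOfSingularities.Theorems.WildQuotientResolution.BlowupExit Summit.ResolutionOfSingularities.ResolutionOfSingularities.Theorems.WildQuotientResolution.S1.KillGlue Summit.ResolutionOfSingularities.ResolutionOfSingularities.Theorems.WildQuotientResolution.S1.CentreGluing Summit.ResolutionOfSingularities.ResolutionOfSingularities.Theorems.WildQuotientResolution.S1.FreeModel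
open Summit.ResolutionOfSingularities.ResolutionOfSingularities.Theorems.WildQuotientResolution.S1.ModelNode Summit.ResolutionOfSingularities.ResolutionOfSingularities.Theorems.WildQuotientResolution.S1.NodeAway Summit.ResolutionOfSingularities.ResolutionOfSingularities.Theorems.WildQuotientResolution.S1.NodeChartAway Summit.ResolutionOfSingularities.ResolutionOfSingularities.Theorems.WildQuotientResolution.S1.CentreAway

namespace Summit.ResolutionOfSingularities.ResolutionOfSingularities.Cruxes.CyclicQuotientFourfolds.CuspKillsInSkeleton

open Summit.ResolutionOfSingularities.ResolutionOfSingularities.Theorems.WildQuotientResolution.S1.GameFrame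
open Summit.ResolutionOfSingularities.ResolutionOfSingularities.Theorems.WildQuotientResolution.S1.GameFrame.GModel

variable {p : ℕ} {X' X₁ : Scheme.{0}} {q : X' ⟶ X₁} {G : Type} [Group G] {ρ : G →* Aut X'} {g₀ : G}

set_option maxHeartbeats 16000000 in
set_option synthInstance.maxHeartbeats 400000 in
/-- SKELETON DRAFT v2 (one sorry inside): `KillsIn 2` for the census cusp `x₁ ↦ x₁ + x₀, x₂ ↦ x₂ + x₀, x₃ ↦ x₃ + (x₂² − x₁³)`, `(2:k) ≠ 0`, `(3:k) ≠ 0`.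
MOVE 1, the move atlas, the transition sections, the global sections with their chart values and the THREE MEMBER CHARTS are real;
the final glue-and-kill step is left `sorry` — see the header. [OURS · draft] -/
theorem cusp_killsIn_two_skeleton [Finite G] (hp : p.Prime) (hG : ∀ g : G, g ∈ Subgroup.zpowers g₀) (hg₀ : g₀ ^ p = 1)
    (hq : ∀ g : G, (ρ g).hom ≫ q = q) [IsIntegral X'] [IsLocallyNoetherian X'] [X'.IsSeparated] [IsAffine X']
    {k' : Type} [Field k'] (φ : X₁ ⟶ Spec (.of k')) [IsSeparated φ] [LocallyOfFiniteType φ] [IsFinite q]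
    {k : Type} [Field k] [Fact p.Prime] [CharP k p] (hk2 : (2 : k) ≠ 0) (hk3 : (3 : k) ≠ 0)
    (σ : (MvPolynomial (Fin 4) k) ≃+* (MvPolynomial (Fin 4) k)) (hC : ∀ a : k, σ (C a) = C a)
    (h0 : σ (X 0) = X 0) (h1 : σ (X 1) = X 1 + X 0) (h2 : σ (X 2) = X 2 + X 0) (h3 : σ (X 3) = X 3 + (X 2 ^ 2 - X 1 ^ 3))
    (e : Γ(X', ⊤) ≃+* (MvPolynomial (Fin 4) k))
    (hστ : ∀ t : Γ(X', ⊤), e ((ρ g₀⁻¹).hom.appLE ⊤ ⊤ (by rw [Scheme.Hom.preimage_top]) t) = σ (e t))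
    (h₀ : NodeAtlas p (⟨ρ, hq⟩ : ActionOver q G) g₀) :
    KillsIn 2 (GModel.initial (p := p) (g₀ := g₀) hq h₀) := by
  classical
  haveI : NeZero p := ⟨hp.ne_zero⟩
  have hp1 : p ≠ 1 := hp.one_lt.ne'
  -- ### the tangency point `Q = (a, c) = (4/9, 8/27)`
  obtain ⟨a, ha9⟩ : ∃ a : k, a * 9 = 4 := ⟨4 / 9, by
    have h9 : (9 : k) ≠ 0 := by rw [show (9 : k) = 3 ^ 2 by norm_num]; exact pow_ne_zero 2 hk3
    field_simp⟩
  obtain ⟨c, hc27⟩ : ∃ c : k, c * 27 = 8 := ⟨8 / 27, by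
    have h27 : (27 : k) ≠ 0 := by rw [show (27 : k) = 3 ^ 3 by norm_num]; exact pow_ne_zero 3 hk3
    field_simp⟩
  have ha : a ≠ 0 := by
    rintro rfl; rw [zero_mul] at ha9
    exact (show (4 : k) ≠ 0 by rw [show (4 : k) = 2 ^ 2 by norm_num]; exact pow_ne_zero 2 hk2) ha9.symm
  have hc0 : c ≠ 0 := by
    rintro rfl; rw [zero_mul] at hc27
    exact (show (8 : k) ≠ 0 by rw [show (8 : k) = 2 ^ 3 by norm_num]; exact pow_ne_zero 3 hk2) hc27.symm
  have h81 : (81 : k) ≠ 0 := by rw [show (81 : k) = 3 ^ 4 by norm_num]; exact pow_ne_zero 4 hk3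
  have h729 : (729 : k) ≠ 0 := by rw [show (729 : k) = 3 ^ 6 by norm_num]; exact pow_ne_zero 6 hk3
  have hQ1 : 2 * c = 3 * a ^ 2 := by
    have h : (2 * c - 3 * a ^ 2) * 81 = 0 := by linear_combination (6 : k) * hc27 - (27 * a + 12) * ha9
    rcases mul_eq_zero.mp h with h | h
    · exact sub_eq_zero.mp h
    · exact absurd h h81
  have hQ2 : c ^ 2 = a ^ 3 := by
    have h : (c ^ 2 - a ^ 3) * 729 = 0 := by linear_combination (c * 27 + 8) * hc27 - ((a * 9) ^ 2 + 4 * (a * 9) + 16) * ha9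
    rcases mul_eq_zero.mp h with h | h
    · exact sub_eq_zero.mp h
    · exact absurd h h729
  have he0 : (2 : k) * (1 - 3 * a) ≠ 0 := by
    intro h
    have h' : (2 * (1 - 3 * a)) * 3 = (-2 : k) := by linear_combination (-2 : k) * ha9
    rw [h, zero_mul] at h'
    exact hk2 (by linear_combination h')
  -- ### the root chart `O = X′`
  haveI : IsAffine (⊤ : X'.Opens) := isAffineOpen_top X'
  have hAff : IsAffineHom ((⊤ : X'.Opens).ι ≫ q) := inferInstance
  have hst : ∀ g : G, (ρ g).hom ⁻¹ᵁ (⊤ : X'.Opens) = ⊤ := fun g => Scheme.Hom.preimage_top _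
  let O : (GModel.initial (p := p) (g₀ := g₀) hq h₀).act.StableAffineOpens := ⟨⊤, hst, hAff⟩
  have hO : IsAffineOpen O.1 := isAffineOpen_top X'
  have hOuniv : ∀ u : (GModel.initial (p := p) (g₀ := g₀) hq h₀).V, u ∈ O.1 := fun _ => Set.mem_univ _
  haveI hsep₀ : (GModel.initial (p := p) (g₀ := g₀) hq h₀).V.IsSeparated := ‹X'.IsSeparated›
  obtain ⟨e₀, he₀⟩ : ∃ e₀ : Γ((GModel.initial (p := p) (g₀ := g₀) hq h₀).V, O.1) ≃+* (MvPolynomial (Fin 4) k), ∀ t, e₀ t = e t := ⟨e, fun _ => rfl⟩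
  have hact : ∀ t : Γ((GModel.initial (p := p) (g₀ := g₀) hq h₀).V, O.1), actOEquiv (GModel.initial (p := p) (g₀ := g₀) hq h₀).act O g₀ t = e₀.symm (σ (e₀ t)) := fun t => e₀.injective (by rw [e₀.apply_symm_apply, he₀, he₀, ← hστ]; rfl)
  have hσp : ∀ a : (MvPolynomial (Fin 4) k), (⇑σ)^[p] a = a := iterate_eq_self_of_chart (GModel.initial (p := p) (g₀ := g₀) hq h₀) O hg₀ e₀ σ hact
  have hcl : ∀ S : Set Γ((GModel.initial (p := p) (g₀ := g₀) hq h₀).V, O.1), IsClosed ((GModel.initial (p := p) (g₀ := g₀) hq h₀).V.zeroLocus (U := O.1) S ∩ (O.1 : Set (GModel.initial (p := p) (g₀ := g₀) hq h₀).V)) := fun S =>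
    ((GModel.initial (p := p) (g₀ := g₀) hq h₀).V.zeroLocus_isClosed _).inter (by exact isClosed_univ)
  -- ### per point (`i = 0`: `O`; `i = 1`: `Q`): recentred chart, localised node `Wᵢ`, admissible root — ONE family (✓`exists_cusp_pointCentre`)
  have hpt := fun i => exists_cusp_pointCentre hG (GModel.initial (p := p) (g₀ := g₀) hq h₀) O hO e₀ σ hC h0 h1 h2 h3 hact hσp hcl a c ha hQ1 hQ2 i
  choose hh hhh γ eI σI hσh hactI hrest using hpt
  have heI : ∀ i t, eI i t = γ i (e₀ t) := fun i => (hrest i).1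
  have hγs0 : ∀ i, (γ i).symm (X 0) = X 0 := fun i => (hrest i).2.1.2.2.2.2.1
  have hγs1 : ∀ i, (γ i).symm (X 1) = X 1 - C ((![(0 : k), a] : Fin 2 → k) i) := fun i => (hrest i).2.1.2.2.2.2.2.1
  have hCI : ∀ i (a : k), σI i (C a) = C a := fun i => (hrest i).2.2.1.1
  have h0I : ∀ i, σI i (X 0) = X 0 := fun i => (hrest i).2.2.1.2.1
  have h1I : ∀ i, σI i (X 1) = X 1 + X 0 := fun i => (hrest i).2.2.1.2.2.1
  have h2I : ∀ i, σI i (X 2) = (![X 2 + X 0, X 2] : Fin 2 → (MvPolynomial (Fin 4) k)) i := fun i => (hrest i).2.2.1.2.2.2.1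
  have h3I : ∀ i, σI i (X 3) = X 3 + ((![(X 2 ^ 2 - X 1 ^ 3 : MvPolynomial (Fin 4) k), (X 2 ^ 2 + 2 * X 1 * X 2 + C (2 * c) * X 2 + C (1 - 3 * a) * X 1 ^ 2 - X 1 ^ 3 : MvPolynomial (Fin 4) k)] : Fin 2 → (MvPolynomial (Fin 4) k)) i) := fun i => (hrest i).2.2.1.2.2.2.2.1
  have hσpI : ∀ i (a : (MvPolynomial (Fin 4) k)), (⇑(σI i))^[p] a = a := fun i => (hrest i).2.2.1.2.2.2.2.2
  have hnode := fun i => (hrest i).2.2.2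
  choose 𝒜u gr eW hfull htame hσW hpinW hKex using hnode
  choose 𝒦 dI hdI hadm hchart hG𝒦 hfil hver hsupp using hKex
  letI : ∀ i, GradedRing (𝒜u i) := gr
  have hW1 : ∀ i, (basicOpenStable (GModel.initial (p := p) (g₀ := g₀) hq h₀).act O hO (actO_symm_eq_of_fixed hG (GModel.initial (p := p) (g₀ := g₀) hq h₀) O (eI i) (σI i) (hactI i) (hh i) (hσh i))).1 = (GModel.initial (p := p) (g₀ := g₀) hq h₀).V.basicOpen ((eI i).symm (hh i)) := fun i => rfl
  have hWaff : ∀ i, IsAffineOpen (basicOpenStable (GModel.initial (p := p) (g₀ := g₀) hq h₀).act O hO (actO_symm_eq_of_fixed hG (GModel.initial (p := p) (g₀ := g₀) hq h₀) O (eI i) (σI i) (hactI i) (hh i) (hσh i))).1 := fun i => hO.basicOpen _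
  have heIs : ∀ i (f : (MvPolynomial (Fin 4) k)), (eI i).symm f = e₀.symm ((γ i).symm f) := fun i f =>
    (eI i).injective (by rw [(eI i).apply_symm_apply, heI, e₀.apply_symm_apply]; exact ((γ i).apply_symm_apply f).symm)
  have hfA : ∀ i (l : Fin 3), (fun l => algebraMap (MvPolynomial (Fin 4) k) (Localization.Away (hh i)) (X ((![0, 1, 2] : Fin 3 → Fin 4) l))) l ∈ 𝒜u i ((fun _ => (0 : (Π j : Fin 0, ZMod ((![] : Fin 0 → ℕ) j)))) l) := fun i l => hfull i _ _
  have hfull0 : ∀ i (x : (Localization.Away (hh i))), x ∈ 𝒜u i 0 := fun i x => hfull i _ _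
  have hw : ∀ i (l : Fin 3), 0 < ((![(![9, 2, 3] : Fin 3 → ℕ), (![3, 1, 2] : Fin 3 → ℕ)] : Fin 2 → (Fin 3 → ℕ)) i) l := fun i l => by fin_cases i <;> fin_cases l <;> decide
  -- ### per-point filtration facts — ONE family (✓`Cusp.cusp_pointFacts`)
  have hfacts := fun i => Cusp.cusp_pointFacts hp.pos a c (σI i) (hCI i) (h0I i) (h1I i) i (h2I i) (h3I i) (hh i) (hσh i) (hσpI i)
  choose ht hσJ H1 hres0 hrest1 using hfacts
  have hσpL : ∀ i (y : (Localization.Away (hh i))), (⇑(sigmaAway (σI i) (hσh i)))^[p] y = y := fun i y => KillCert.QhAway.qhl_iterate (σI i) (hh i) (hσh i) (hσpI i) y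
  have hα : Function.Injective (![(0 : k), a] : Fin 2 → k) := injective_zero_pair ha
  have hne : ∀ i, ∀ j ∈ Finset.univ.erase i, (![(0 : k), a] : Fin 2 → k) i - (![(0 : k), a] : Fin 2 → k) j ≠ 0 := fun i j hj h =>
    Finset.ne_of_mem_erase hj (hα (sub_eq_zero.mp h)).symm
  have hh0ev : ∀ i, MvPolynomial.eval (fun _ : Fin 4 => (0 : k)) (hh i) ≠ 0 := fun i => hhh i ▸ GraphTail.eval_locPoly_ne_zero _ _ (hne i) _ rfl rfl
  have hh0 : ∀ i, hh i ≠ 0 := fun i h => hh0ev i (by rw [h, map_zero])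
  have hK1 : ∀ i, RingTheory.Sequence.IsRegular (Localization.Away (hh i)) (List.ofFn (fun l => algebraMap (MvPolynomial (Fin 4) k) (Localization.Away (hh i)) (X ((![0, 1, 2] : Fin 3 → Fin 4) l)))) := fun i =>
    KillCert.QhAway.qhl_isRegular (hh i) (fun _ => (0 : k)) rfl rfl rfl (hh0ev i)
  have hK1' : ∀ i, IsRegularRing ((Localization.Away (hh i)) ⧸ Ideal.span (Set.range (fun l => algebraMap (MvPolynomial (Fin 4) k) (Localization.Away (hh i)) (X ((![0, 1, 2] : Fin 3 → Fin 4) l))))) := fun i => KillCert.QhAway.qhl_isRegularRing_quotient (hh i)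
  -- ### the common Veronese degree `D = d₀ d₁`
  obtain ⟨D, hDdef⟩ : ∃ D : ℕ, D = ∏ i, dI i := ⟨_, rfl⟩
  have hDmul : ∀ i, dI i * ∏ j ∈ Finset.univ.erase i, dI j = D := fun i => hDdef ▸ Finset.mul_prod_erase Finset.univ dI (Finset.mem_univ i)
  have hlpos : ∀ i, 0 < ∏ j ∈ Finset.univ.erase i, dI j := fun i => Finset.prod_pos fun j _ => hdI j
  have hD : 0 < D := by rw [hDdef]; exact Finset.prod_pos fun j _ => hdI j
  have hadmD : ∀ i, IsAdmissibleCentre p (GModel.initial (p := p) (g₀ := g₀) hq h₀).act g₀ (𝒦 i) D := fun i => hDmul i ▸ isAdmissibleCentre_mul (hadm i) (hlpos i)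
  have hverD : ∀ i, VeroneseNormalised (𝒜u i) (fun l => algebraMap (MvPolynomial (Fin 4) k) (Localization.Away (hh i)) (X ((![0, 1, 2] : Fin 3 → Fin 4) l))) ((![(![9, 2, 3] : Fin 3 → ℕ), (![3, 1, 2] : Fin 3 → ℕ)] : Fin 2 → (Fin 3 → ℕ)) i) D := fun i => hDmul i ▸ CoarseChart.veroneseNormalised_mul _ _ _ (hver i) (hlpos i)
  have hsuppD : ∀ i, ((((𝒦 i).ideal D).support : Set (GModel.initial (p := p) (g₀ := g₀) hq h₀).V)) ⊆ ((basicOpenStable (GModel.initial (p := p) (g₀ := g₀) hq h₀).act O hO (actO_symm_eq_of_fixed hG (GModel.initial (p := p) (g₀ := g₀) hq h₀) O (eI i) (σI i) (hactI i) (hh i) (hσh i))).1 : Set (GModel.initial (p := p) (g₀ := g₀) hq h₀).V) := fun i => support_ideal_eq_of_pos (𝒦 i) hD (hdI i) ▸ hsupp i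
  -- ### disjointness of the supports: `supp 𝒦ᵢ ⊆ Wᵢ ∩ V(x₁ − αᵢ)`, `Wⱼ ⊆ D(x₁ − αᵢ)` for `j ≠ i`
  have hBsub : ∀ i, ∀ v ∈ ((((𝒦 i).ideal D).support : Set (GModel.initial (p := p) (g₀ := g₀) hq h₀).V)), v ∉ (GModel.initial (p := p) (g₀ := g₀) hq h₀).V.basicOpen ((eI i).symm (X 1)) := by
    intro i v hv hvB
    have hvW : v ∈ (basicOpenStable (GModel.initial (p := p) (g₀ := g₀) hq h₀).act O hO (actO_symm_eq_of_fixed hG (GModel.initial (p := p) (g₀ := g₀) hq h₀) O (eI i) (σI i) (hactI i) (hh i) (hσh i))).1 := hsuppD i hv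
    have hs1 : algebraMap Γ((GModel.initial (p := p) (g₀ := g₀) hq h₀).V, O.1) Γ((GModel.initial (p := p) (g₀ := g₀) hq h₀).V, (GModel.initial (p := p) (g₀ := g₀) hq h₀).V.basicOpen ((eI i).symm (hh i))) ((eI i).symm (X 1)) ∈ ((𝒦 i).filtration ⟨(basicOpenStable (GModel.initial (p := p) (g₀ := g₀) hq h₀).act O hO (actO_symm_eq_of_fixed hG (GModel.initial (p := p) (g₀ := g₀) hq h₀) O (eI i) (σI i) (hactI i) (hh i) (hσh i))).1, hWaff i⟩).ideal (((![(![9, 2, 3] : Fin 3 → ℕ), (![3, 1, 2] : Fin 3 → ℕ)] : Fin 2 → (Fin 3 → ℕ)) i) 1) := by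
      rw [hfil i (((![(![9, 2, 3] : Fin 3 → ℕ), (![3, 1, 2] : Fin 3 → ℕ)] : Fin 2 → (Fin 3 → ℕ)) i) 1)]
      refine Ideal.mem_comap.mpr ?_
      change eW i (algebraMap Γ((GModel.initial (p := p) (g₀ := g₀) hq h₀).V, O.1) Γ((GModel.initial (p := p) (g₀ := g₀) hq h₀).V, (GModel.initial (p := p) (g₀ := g₀) hq h₀).V.basicOpen ((eI i).symm (hh i))) ((eI i).symm (X 1))) ∈ (traceFiltration (𝒜u i) (fun l => algebraMap (MvPolynomial (Fin 4) k) (Localization.Away (hh i)) (X ((![0, 1, 2] : Fin 3 → Fin 4) l))) ((![(![9, 2, 3] : Fin 3 → ℕ), (![3, 1, 2] : Fin 3 → ℕ)] : Fin 2 → (Fin 3 → ℕ)) i)).ideal (((![(![9, 2, 3] : Fin 3 → ℕ), (![3, 1, 2] : Fin 3 → ℕ)] : Fin 2 → (Fin 3 → ℕ)) i) 1)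
      rw [mem_traceFiltration_iff, hpinW i, (eI i).apply_symm_apply]
      exact mem_weightedFiltration_ideal (fun l => algebraMap (MvPolynomial (Fin 4) k) (Localization.Away (hh i)) (X ((![0, 1, 2] : Fin 3 → Fin 4) l))) ((![(![9, 2, 3] : Fin 3 → ℕ), (![3, 1, 2] : Fin 3 → ℕ)] : Fin 2 → (Fin 3 → ℕ)) i) 1
    have hnot : v ∉ (GModel.initial (p := p) (g₀ := g₀) hq h₀).V.basicOpen (algebraMap Γ((GModel.initial (p := p) (g₀ := g₀) hq h₀).V, O.1) Γ((GModel.initial (p := p) (g₀ := g₀) hq h₀).V, (GModel.initial (p := p) (g₀ := g₀) hq h₀).V.basicOpen ((eI i).symm (hh i))) ((eI i).symm (X 1))) :=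
      ReesFiltration.not_mem_basicOpen_of_mem_support (𝒦 i) hD (hw i 1) ⟨(basicOpenStable (GModel.initial (p := p) (g₀ := g₀) hq h₀).act O hO (actO_symm_eq_of_fixed hG (GModel.initial (p := p) (g₀ := g₀) hq h₀) O (eI i) (σI i) (hactI i) (hh i) (hσh i))).1, hWaff i⟩ _ hs1 hv hvW
    rw [RingHom.algebraMap_toAlgebra, Scheme.basicOpen_res] at hnot
    exact hnot ⟨(hW1 i).le hvW, hvB⟩
  have hWle : ∀ i j, i ≠ j → (basicOpenStable (GModel.initial (p := p) (g₀ := g₀) hq h₀).act O hO (actO_symm_eq_of_fixed hG (GModel.initial (p := p) (g₀ := g₀) hq h₀) O (eI j) (σI j) (hactI j) (hh j) (hσh j))).1 ≤ (GModel.initial (p := p) (g₀ := g₀) hq h₀).V.basicOpen ((eI i).symm (X 1)) := by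
    intro i j hij
    have hdvd : (X 1 - C ((![(0 : k), a] : Fin 2 → k) i) : (MvPolynomial (Fin 4) k)) ∣ (γ j).symm (hh j) := by
      rw [hhh j, map_prod]
      refine dvd_trans ?_ (Finset.dvd_prod_of_mem _ (Finset.mem_erase.mpr ⟨hij, Finset.mem_univ i⟩))
      rw [map_prod]
      refine dvd_trans ?_ (Finset.dvd_prod_of_mem _ (Finset.mem_univ (0 : ZMod p)))
      rw [ZMod.val_zero, Nat.cast_zero, zero_mul, add_zero, map_add, hγs1 j,
        show (γ j).symm (C ((![(0 : k), a] : Fin 2 → k) j - (![(0 : k), a] : Fin 2 → k) i)) = C ((![(0 : k), a] : Fin 2 → k) j - (![(0 : k), a] : Fin 2 → k) i) from (γ j).symm.commutes _, map_sub]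
      exact ⟨1, by ring⟩
    obtain ⟨cc, hcc⟩ := hdvd
    rw [hW1 j, heIs j, hcc, map_mul, Scheme.basicOpen_mul, heIs i, hγs1]
    exact inf_le_left
  have hdisj : Pairwise fun i j => Disjoint ((((𝒦 i).ideal D).support : Set (GModel.initial (p := p) (g₀ := g₀) hq h₀).V)) ((((𝒦 j).ideal D).support : Set (GModel.initial (p := p) (g₀ := g₀) hq h₀).V)) := fun i j hij =>
    Set.disjoint_left.mpr fun v hvi hvj => hBsub i v hvi (hWle i j hij (hsuppD j hvj))
  have hWoff : ∀ i j, j ≠ i → Disjoint (((basicOpenStable (GModel.initial (p := p) (g₀ := g₀) hq h₀).act O hO (actO_symm_eq_of_fixed hG (GModel.initial (p := p) (g₀ := g₀) hq h₀) O (eI i) (σI i) (hactI i) (hh i) (hσh i))).1 : Set (GModel.initial (p := p) (g₀ := g₀) hq h₀).V)) ((((𝒦 j).ideal D).support : Set (GModel.initial (p := p) (g₀ := g₀) hq h₀).V)) := fun i j hji =>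
    Set.disjoint_left.mpr fun v hvW hvj => hBsub j v hvj (hWle j i hji hvW)
  -- ### the glued centre of MOVE 1
  have hadmg := MultiRoot.isAdmissibleCentre_infRees_of_disjoint (GModel.initial (p := p) (g₀ := g₀) hq h₀) 𝒦 hD hadmD hdisj
  have h𝒦G : ∀ (g' : G) (n : ℕ), ((infRees 𝒦).ideal n).comap ((GModel.initial (p := p) (g₀ := g₀) hq h₀).act.aut g').hom = (infRees 𝒦).ideal n := hadmg.2.1
  have h𝒦O : ∀ i n, ((infRees 𝒦).filtration ⟨(basicOpenStable (GModel.initial (p := p) (g₀ := g₀) hq h₀).act O hO (actO_symm_eq_of_fixed hG (GModel.initial (p := p) (g₀ := g₀) hq h₀) O (eI i) (σI i) (hactI i) (hh i) (hσh i))).1, hWaff i⟩).ideal n = ((traceFiltration (𝒜u i) (fun l => algebraMap (MvPolynomial (Fin 4) k) (Localization.Away (hh i)) (X ((![0, 1, 2] : Fin 3 → Fin 4) l))) ((![(![9, 2, 3] : Fin 3 → ℕ), (![3, 1, 2] : Fin 3 → ℕ)] : Fin 2 → (Fin 3 → ℕ)) i)).ideal n).comap (eW i : Γ((GModel.initial (p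 := p) (g₀ := g₀) hq h₀).V, (basicOpenStable (GModel.initial (p := p) (g₀ := g₀) hq h₀).act O hO (actO_symm_eq_of_fixed hG (GModel.initial (p := p) (g₀ := g₀) hq h₀) O (eI i) (σI i) (hactI i) (hh i) (hσh i))).1) →+* ↥(𝒜u i 0)) :=
    fun i n => (MultiRoot.filtration_infRees_eq_of_disjoint 𝒦 hD ⟨(basicOpenStable (GModel.initial (p := p) (g₀ := g₀) hq h₀).act O hO (actO_symm_eq_of_fixed hG (GModel.initial (p := p) (g₀ := g₀) hq h₀) O (eI i) (σI i) (hactI i) (hh i) (hσh i))).1, hWaff i⟩ i (hWoff i) n).trans (hfil i n)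
  have hsuppW : (((((infRees 𝒦).ideal D).support : Set (GModel.initial (p := p) (g₀ := g₀) hq h₀).V))) ⊆ ⋃ i, ((basicOpenStable (GModel.initial (p := p) (g₀ := g₀) hq h₀).act O hO (actO_symm_eq_of_fixed hG (GModel.initial (p := p) (g₀ := g₀) hq h₀) O (eI i) (σI i) (hactI i) (hh i) (hσh i))).1 : Set (GModel.initial (p := p) (g₀ := g₀) hq h₀).V) :=
    (MultiRoot.support_infRees_subset 𝒦 D).trans (Set.iUnion_mono fun i => hsuppD i)
  have hb : ∀ i, e₀ ((eI i).symm (hh i)) = ∏ j ∈ Finset.univ.erase i, ∏ l : ZMod p, (X 1 - C ((![(0 : k), a] : Fin 2 → k) i) + C ((![(0 : k), a] : Fin 2 → k) i - (![(0 : k), a] : Fin 2 → k) j) + (l.val : (MvPolynomial (Fin 4) k)) * X 0) := by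
    intro i
    rw [heIs, e₀.apply_symm_apply, hhh i, map_prod]
    refine Finset.prod_congr rfl fun j _ => ?_
    rw [map_prod]
    refine Finset.prod_congr rfl fun l _ => ?_
    rw [map_add, map_add, map_mul, map_natCast, hγs1, hγs0, show (γ i).symm (C ((![(0 : k), a] : Fin 2 → k) i - (![(0 : k), a] : Fin 2 → k) j)) = C ((![(0 : k), a] : Fin 2 → k) i - (![(0 : k), a] : Fin 2 → k) j) from (γ i).symm.commutes _]
  have hF₀ : (NodeAtlasData.ofNodeAtlas (p := p) (ρ := (⟨ρ, hq⟩ : ActionOver q G)) (g₀ := g₀) h₀).fLocus ⊆ ⋃ i, ((basicOpenStable (GModel.initial (p := p) (g₀ := g₀) hq h₀).act O hO (actO_symm_eq_of_fixed hG (GModel.initial (p := p) (g₀ := g₀) hq h₀) O (eI i) (σI i) (hactI i) (hh i) (hσh i))).1 : Set (GModel.initial (p := p) (g₀ := g₀) hq h₀).V) :=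
    fLocus_subset_iUnion_basicOpen_locPoly hG (GModel.initial (p := p) (g₀ := g₀) hq h₀) O hOuniv e₀ σ hC h0 h1 hact (by decide : 0 < 2) (![(0 : k), a] : Fin 2 → k) hα (fun i => (eI i).symm (hh i)) hb _
  have hcovX : ∀ u : (GModel.initial (p := p) (g₀ := g₀) hq h₀).V, u ∈ (GModel.initial (p := p) (g₀ := g₀) hq h₀).V.basicOpen (e₀.symm (X 0)) ∨ ∃ i, u ∈ (basicOpenStable (GModel.initial (p := p) (g₀ := g₀) hq h₀).act O hO (actO_symm_eq_of_fixed hG (GModel.initial (p := p) (g₀ := g₀) hq h₀) O (eI i) (σI i) (hactI i) (hh i) (hσh i))).1 := fun u =>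
    mem_basicOpen_X_zero_or_locPoly (GModel.initial (p := p) (g₀ := g₀) hq h₀) O e₀ (by decide : 0 < 2) (![(0 : k), a] : Fin 2 → k) hα (fun i => (eI i).symm (hh i)) hb (hOuniv u)
  -- ### KillsIn 2: MOVE 1 is the glued root; fix a realisation `M₁`
  refine ⟨infRees 𝒦, D, hadmg, fun M₁ hm₁ => ⟨⟨NodeAtlasData.ofNodeAtlas (p := p) (ρ := M₁.act) (g₀ := g₀) M₁.atlas⟩, ?_⟩⟩
  obtain ⟨π₁, hbl, -, hrM, hcomm⟩ := hm₁
  haveI : M₁.V.IsSeparated := isSeparated_of_datum φ M₁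
  haveI : IsIntegral M₁.V := M₁.isIntegral
  -- ### MOVE 1 on `M₁`: per-point ring data at the common degree `DB = D·p·18` — ONE family (✓`Cusp.cusp_ringData`)
  have hkk : 0 < (p * 18) := Nat.mul_pos hp.pos (by decide)
  have hn₀ : ∀ i, 0 < ((![2 * D * p, 6 * D * p] : Fin 2 → ℕ) i) := fun i => by fin_cases i <;> simp [hD, hp.pos]
  have hn₁ : ∀ i, 0 < ((![9 * D, 18 * D] : Fin 2 → ℕ) i) := fun i => by fin_cases i <;> simp [hD]
  have hn₂ : ∀ i, 0 < ((![6 * D, 9 * D] : Fin 2 → ℕ) i) := fun i => by fin_cases i <;> simp [hD]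
  have hd₀ : ∀ i, (D * (p * 18)) = ((![(![9, 2, 3] : Fin 3 → ℕ), (![3, 1, 2] : Fin 3 → ℕ)] : Fin 2 → (Fin 3 → ℕ)) i) 0 * ((![2 * D * p, 6 * D * p] : Fin 2 → ℕ) i) := fun i => by fin_cases i <;> simp <;> ring
  have hd₁ : ∀ i, (D * (p * 18)) = p * ((![(![9, 2, 3] : Fin 3 → ℕ), (![3, 1, 2] : Fin 3 → ℕ)] : Fin 2 → (Fin 3 → ℕ)) i) 1 * ((![9 * D, 18 * D] : Fin 2 → ℕ) i) := fun i => by fin_cases i <;> simp <;> ring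
  have hd₂ : ∀ i, (D * (p * 18)) = p * ((![(![9, 2, 3] : Fin 3 → ℕ), (![3, 1, 2] : Fin 3 → ℕ)] : Fin 2 → (Fin 3 → ℕ)) i) 2 * ((![6 * D, 9 * D] : Fin 2 → ℕ) i) := fun i => by fin_cases i <;> simp <;> ring
  have hrd := fun i => Cusp.cusp_ringData hp.pos a c (σI i) (hCI i) (h0I i) (h1I i) i (h2I i) (h3I i) (hh i) (hσh i) (hh0 i) (hσpI i) (hσpL i) (hσJ i)
    ![] (𝒜u i) (hfull0 i) (D * (p * 18)) ((![2 * D * p, 6 * D * p] : Fin 2 → ℕ) i) ((![9 * D, 18 * D] : Fin 2 → ℕ) i) ((![6 * D, 9 * D] : Fin 2 → ℕ) i) (hn₀ i) (hn₁ i) (hn₂ i) (hd₀ i) (hd₁ i) (hd₂ i)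
  choose y hy hσy hy0 hy1 hy2 hcov0 hcov1 hcov2 hrad hres using hrd
  -- the tail residual sections `t̂^{DB/sh}/c` (✓`QhAbs.qha_residualSection_tail`)
  have hnT : ∀ i, 0 < ((![3 * D * p, 9 * D * p] : Fin 2 → ℕ) i) := fun i => by fin_cases i <;> simp [hD, hp.pos]
  have hdT : ∀ i, (D * (p * 18)) = ((![6, 2] : Fin 2 → ℕ) i) * ((![3 * D * p, 9 * D * p] : Fin 2 → ℕ) i) := fun i => by fin_cases i <;> simp <;> ring
  have hresT := fun i j => QhAbs.qha_residualSection_tail (fun l => algebraMap (MvPolynomial (Fin 4) k) (Localization.Away (hh i)) (X ((![0, 1, 2] : Fin 3 → Fin 4) l))) (algebraMap (MvPolynomial (Fin 4) k) (Localization.Away (hh i)) ((![(X 2 ^ 2 - X 1 ^ 3 : MvPolynomial (Fin 4) k), (X 2 ^ 2 + 2 * X 1 * X 2 + C (2 * c) * X 2 + C (1 - 3 * a) * X 1 ^ 2 - X 1 ^ 3 : MvPolynomial (Fin 4) k)] : Fin 2 → (MvPolynomial (Fin 4) k)) i)) ((![(![9, 2, 3] : Fin 3 → ℕ), (![3, 1,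 2] : Fin 3 → ℕ)] : Fin 2 → (Fin 3 → ℕ)) i) ((![6, 2] : Fin 2 → ℕ) i) (ht i) ![] (𝒜u i) (hfA i) (hfull0 i _)
    (y i j) (hy i j) ((![3 * D * p, 9 * D * p] : Fin 2 → ℕ) i) (hdT i) _ (hrest1 i) (hnT i)
  obtain ⟨OW, hOWaff, hOWeq, E, htame', hE', hpin, 𝔄₁, hF₁⟩ := exists_moveAtlas_of_nodes hp.pos hG (GModel.initial (p := p) (g₀ := g₀) hq h₀) M₁
    (NodeAtlasData.ofNodeAtlas (p := p) (ρ := (⟨ρ, hq⟩ : ActionOver q G)) (g₀ := g₀) h₀) (fun i => (basicOpenStable (GModel.initial (p := p) (g₀ := g₀) hq h₀).act O hO (actO_symm_eq_of_fixed hG (GModel.initial (p := p) (g₀ := g₀) hq h₀) O (eI i) (σI i) (hactI i) (hh i) (hσh i)))) hWaff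
    ![] 𝒜u (fun i => (fun l => algebraMap (MvPolynomial (Fin 4) k) (Localization.Away (hh i)) (X ((![0, 1, 2] : Fin 3 → Fin 4) l)))) (δ := fun _ _ => (0 : (Π j : Fin 0, ZMod ((![] : Fin 0 → ℕ) j)))) (fun i => ((![(![9, 2, 3] : Fin 3 → ℕ), (![3, 1, 2] : Fin 3 → ℕ)] : Fin 2 → (Fin 3 → ℕ)) i)) hfA (fun i => (sigmaAway (σI i) (hσh i))) eW htame hσpL hσW hw hK1 hK1' hσJ
    (infRees 𝒦) D h𝒦G h𝒦O hverD hsuppW π₁ hbl hrM hcomm hkk y hy hσy hrad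
    (fun i => cobordantAlgebra.s (fun l => algebraMap (MvPolynomial (Fin 4) k) (Localization.Away (hh i)) (X ((![0, 1, 2] : Fin 3 → Fin 4) l))) ((![(![9, 2, 3] : Fin 3 → ℕ), (![3, 1, 2] : Fin 3 → ℕ)] : Fin 2 → (Fin 3 → ℕ)) i) ^ ((![6, 2] : Fin 2 → ℕ) i)) H1
    (fun _ _ => 2)
    (fun i j => ![algebraMap _ (ChartRing (𝒜u i) (fun l => algebraMap (MvPolynomial (Fin 4) k) (Localization.Away (hh i)) (X ((![0, 1, 2] : Fin 3 → Fin 4) l))) ((![(![9, 2, 3] : Fin 3 → ℕ), (![3, 1, 2] : Fin 3 → ℕ)] : Fin 2 → (Fin 3 → ℕ)) i) (D * (p * 18)) (y i j) (hy i j)) (cobordantAlgebra.u' (fun l => algebraMap (MvPolynomial (Fin 4) k) (Localization.Away (hh i)) (X ((![0, 1, 2] : Fin 3 → Fin 4) l))) ((![(![9, 2, 3] : Fin 3 → ℕ), (![3, 1, 2] : Fin 3 → ℕ)] : Fin 2 → (Fin 3 → ℕ)) i) 0 ^ ((![2 * D * p, 6 * D * p] : Fin 2 → ℕ) i)) * IsLocalization.Away.invSelf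 ((coverElement (𝒜u i) (fun l => algebraMap (MvPolynomial (Fin 4) k) (Localization.Away (hh i)) (X ((![0, 1, 2] : Fin 3 → Fin 4) l))) ((![(![9, 2, 3] : Fin 3 → ℕ), (![3, 1, 2] : Fin 3 → ℕ)] : Fin 2 → (Fin 3 → ℕ)) i) (D * (p * 18))) (y i j) (hy i j)),
      algebraMap _ (ChartRing (𝒜u i) (fun l => algebraMap (MvPolynomial (Fin 4) k) (Localization.Away (hh i)) (X ((![0, 1, 2] : Fin 3 → Fin 4) l))) ((![(![9, 2, 3] : Fin 3 → ℕ), (![3, 1, 2] : Fin 3 → ℕ)] : Fin 2 → (Fin 3 → ℕ)) i) (D * (p * 18)) (y i j) (hy i j)) ((⟨_, C_mul_T_mem_cobordantAlgebra _ _ (ht i)⟩ : ↥(cobordantAlgebra (fun l => algebraMap (MvPolynomial (Fin 4) k) (Localization.Away (hh i)) (X ((![0, 1, 2] : Fin 3 → Fin 4) l))) ((![(![9, 2, 3] : Fin 3 → ℕ), (![3, 1, 2] : Fin 3 → ℕ)] : Fin 2 → (Fin 3 → ℕ)) i))) ^ ((![3 * D * p, 9 * D * p] : Fin 2 → ℕ)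 i)) * IsLocalization.Away.invSelf ((coverElement (𝒜u i) (fun l => algebraMap (MvPolynomial (Fin 4) k) (Localization.Away (hh i)) (X ((![0, 1, 2] : Fin 3 → Fin 4) l))) ((![(![9, 2, 3] : Fin 3 → ℕ), (![3, 1, 2] : Fin 3 → ℕ)] : Fin 2 → (Fin 3 → ℕ)) i) (D * (p * 18))) (y i j) (hy i j))])
    (fun i j l => Fin.cases (hres i j).1 (Fin.cases (hresT i j).1 (fun l' => l'.elim0)) l)
    (fun i j l => Fin.cases (hres i j).2 (Fin.cases (hresT i j).2 (fun l' => l'.elim0)) l)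
  have hWle₁ : ∀ i j, (OW i j).1 ≤ π₁ ⁻¹ᵁ (basicOpenStable (GModel.initial (p := p) (g₀ := g₀) hq h₀).act O hO (actO_symm_eq_of_fixed hG (GModel.initial (p := p) (g₀ := g₀) hq h₀) O (eI i) (σI i) (hactI i) (hh i) (hσh i))).1 := fun i j => by rw [hOWeq i j]; exact blowupChart_le_preimage π₁ _ ⟨(basicOpenStable (GModel.initial (p := p) (g₀ := g₀) hq h₀).act O hO (actO_symm_eq_of_fixed hG (GModel.initial (p := p) (g₀ := g₀) hq h₀) O (eI i) (σI i) (hactI i) (hh i) (hσh i))).1, hWaff i⟩ _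
  -- ### the charts `(i,0)` are killed (`z₀` is a unit there)
  have hunit0 : ∀ i, algebraMap _ (ChartRing (𝒜u i) (fun l => algebraMap (MvPolynomial (Fin 4) k) (Localization.Away (hh i)) (X ((![0, 1, 2] : Fin 3 → Fin 4) l))) ((![(![9, 2, 3] : Fin 3 → ℕ), (![3, 1, 2] : Fin 3 → ℕ)] : Fin 2 → (Fin 3 → ℕ)) i) (D * (p * 18)) (y i 0) (hy i 0)) (cobordantAlgebra.u' (fun l => algebraMap (MvPolynomial (Fin 4) k) (Localization.Away (hh i)) (X ((![0, 1, 2] : Fin 3 → Fin 4) l))) ((![(![9, 2, 3] : Fin 3 → ℕ), (![3, 1, 2] : Fin 3 → ℕ)] : Fin 2 → (Fin 3 → ℕ)) i) 0 ^ ((![2 * D * p, 6 * D * p] : Fin 2 → ℕ) i)) * IsLocalization.Away.invSelf ((coverElement (𝒜u i) (fun l => algebraMap (MvPolynomial (Fin 4) k) (Localization.Away (hh i)) (X ((![0, 1, 2] : Fin 3 → Fin 4) l))) ((![(![9, 2, 3] : Fin 3 → ℕ), (![3, 1, 2] : Fin 3 → ℕ)] : Fin 2 → (Fin 3 → ℕ))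 i) (D * (p * 18))) (y i 0) (hy i 0)) = 1 :=
    fun i => by rw [← hcov0 i]; exact IsLocalization.Away.mul_invSelf _
  have hz0W : ∀ i, ∀ v ∈ (OW i 0).1, v ∈ M₁.V.basicOpen
      (letI := chartNodeGradedRing ![] (𝒜u i) (fun l => algebraMap (MvPolynomial (Fin 4) k) (Localization.Away (hh i)) (X ((![0, 1, 2] : Fin 3 → Fin 4) l))) ((![(![9, 2, 3] : Fin 3 → ℕ), (![3, 1, 2] : Fin 3 → ℕ)] : Fin 2 → (Fin 3 → ℕ)) i) (hfA i) (D * (p * 18)) (y i 0) (hy i 0); (E i 0).symm ⟨_, (hres i 0).1⟩) := fun i v hv => by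
    letI := chartNodeGradedRing ![] (𝒜u i) (fun l => algebraMap (MvPolynomial (Fin 4) k) (Localization.Away (hh i)) (X ((![0, 1, 2] : Fin 3 → Fin 4) l))) ((![(![9, 2, 3] : Fin 3 → ℕ), (![3, 1, 2] : Fin 3 → ℕ)] : Fin 2 → (Fin 3 → ℕ)) i) (hfA i) (D * (p * 18)) (y i 0) (hy i 0)
    rw [show (⟨_, (hres i 0).1⟩ : ↥((chartNodeGrading ![] (𝒜u i) (fun l => algebraMap (MvPolynomial (Fin 4) k) (Localization.Away (hh i)) (X ((![0, 1, 2] : Fin 3 → Fin 4) l))) ((![(![9, 2, 3] : Fin 3 → ℕ), (![3, 1, 2] : Fin 3 → ℕ)] : Fin 2 → (Fin 3 → ℕ)) i) (hfA i) (D * (p * 18)) (y i 0) (hy i 0)) 0)) = 1 from Subtype.ext (hunit0 i), map_one, Scheme.basicOpen_of_isUnit _ isUnit_one]; exact hv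
  -- ### the producer charts cover `π⁻¹ Wᵢ`; transition sections
  have hπ' : IsBlowup π₁ ((infRees 𝒦).ideal D ^ (p * 18)) := isBlowup_pow hbl hkk.ne'
  have hverbar : ∀ i, VeroneseNormalised (𝒜u i) (fun l => algebraMap (MvPolynomial (Fin 4) k) (Localization.Away (hh i)) (X ((![0, 1, 2] : Fin 3 → Fin 4) l))) ((![(![9, 2, 3] : Fin 3 → ℕ), (![3, 1, 2] : Fin 3 → ℕ)] : Fin 2 → (Fin 3 → ℕ)) i) (D * (p * 18)) := fun i => CoarseChart.veroneseNormalised_mul _ _ _ (hverD i) hkk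
  have hJ' : ∀ i, ((infRees 𝒦).ideal D ^ (p * 18)).ideal ⟨(basicOpenStable (GModel.initial (p := p) (g₀ := g₀) hq h₀).act O hO (actO_symm_eq_of_fixed hG (GModel.initial (p := p) (g₀ := g₀) hq h₀) O (eI i) (σI i) (hactI i) (hh i) (hσh i))).1, hWaff i⟩ = ((traceFiltration (𝒜u i) (fun l => algebraMap (MvPolynomial (Fin 4) k) (Localization.Away (hh i)) (X ((![0, 1, 2] : Fin 3 → Fin 4) l))) ((![(![9, 2, 3] : Fin 3 → ℕ), (![3, 1, 2] : Fin 3 → ℕ)] : Fin 2 → (Fin 3 → ℕ)) i)).ideal (D * (p * 18))).comap (eW i : Γ((GModel.initial (p := p) (g₀ := g₀) hq h₀).V, (basicOpenStable (GModel.initial (p := p) (g₀ := g₀) hq h₀).act O hO (actO_symm_eq_of_fixed hG (GModel.initial (p := p) (g₀ := g₀) hq h₀) O (eI i) (σI i) (hactI i) (hh i) (hσh i))).1) →+* ↥(𝒜u i 0)) := fun i => by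
    rw [Scheme.IdealSheafData.ideal_pow, Pi.pow_apply, ← ReesFiltration.filtration_ideal, h𝒦O i D, (hverD i).2 (p * 18), comap_equiv_pow]
  have hxJ : ∀ i j, (eW i).symm (y i j) ∈ ((infRees 𝒦).ideal D ^ (p * 18)).ideal ⟨(basicOpenStable (GModel.initial (p := p) (g₀ := g₀) hq h₀).act O hO (actO_symm_eq_of_fixed hG (GModel.initial (p := p) (g₀ := g₀) hq h₀) O (eI i) (σI i) (hactI i) (hh i) (hσh i))).1, hWaff i⟩ := fun i j => by
    rw [hJ' i, Ideal.mem_comap, RingHom.coe_coe, (eW i).apply_symm_apply]; exact hy i j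
  have hcovM : ∀ (x : M₁.V) i, π₁.base x ∈ (basicOpenStable (GModel.initial (p := p) (g₀ := g₀) hq h₀).act O hO (actO_symm_eq_of_fixed hG (GModel.initial (p := p) (g₀ := g₀) hq h₀) O (eI i) (σI i) (hactI i) (hh i) (hσh i))).1 → ∃ j, x ∈ (OW i j).1 := fun x i hxi => by
    have hcovW := iSup_blowupChart_eq_preimage (I := (infRees 𝒦).ideal D) (GModel.initial (p := p) (g₀ := g₀) hq h₀).act ![] (𝒜u i) (fun l => algebraMap (MvPolynomial (Fin 4) k) (Localization.Away (hh i)) (X ((![0, 1, 2] : Fin 3 → Fin 4) l))) ((![(![9, 2, 3] : Fin 3 → ℕ), (![3, 1, 2] : Fin 3 → ℕ)] : Fin 2 → (Fin 3 → ℕ)) i) (hfA i) (basicOpenStable (GModel.initial (p := p) (g₀ := g₀) hq h₀).act O hO (actO_symm_eq_of_fixed hG (GModel.initial (p := p) (g₀ := g₀) hq h₀) O (eI i) (σI i) (hactI i) (hh i) (hσh i))) (hWaff i) (eW i) hπ' (hverbar i) (hJ' i) (y i) (hy i) (hrad i)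
    obtain ⟨j, hj⟩ := Opens.mem_iSup.mp (show x ∈ ⨆ j, blowupChart π₁ ((infRees 𝒦).ideal D ^ (p * 18)) ⟨(basicOpenStable (GModel.initial (p := p) (g₀ := g₀) hq h₀).act O hO (actO_symm_eq_of_fixed hG (GModel.initial (p := p) (g₀ := g₀) hq h₀) O (eI i) (σI i) (hactI i) (hh i) (hσh i))).1, hWaff i⟩ ((eW i).symm (y i j)) by rw [hcovW]; exact hxi)
    exact ⟨j, (congrArg (fun U : M₁.V.Opens => x ∈ U) (hOWeq i j)).mpr hj⟩
  have htrans : ∀ i (j j' : Fin 3), letI := chartNodeGradedRing ![] (𝒜u i) (fun l => algebraMap (MvPolynomial (Fin 4) k) (Localization.Away (hh i)) (X ((![0, 1, 2] : Fin 3 → Fin 4) l))) ((![(![9, 2, 3] : Fin 3 → ℕ), (![3, 1, 2] : Fin 3 → ℕ)] : Fin 2 → (Fin 3 → ℕ)) i) (hfA i) (D * (p * 18)) (y i j) (hy i j)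
      ∃ t : Γ(M₁.V, (OW i j).1),
        ((E i j t : ↥((chartNodeGrading ![] (𝒜u i) (fun l => algebraMap (MvPolynomial (Fin 4) k) (Localization.Away (hh i)) (X ((![0, 1, 2] : Fin 3 → Fin 4) l))) ((![(![9, 2, 3] : Fin 3 → ℕ), (![3, 1, 2] : Fin 3 → ℕ)] : Fin 2 → (Fin 3 → ℕ)) i) (hfA i) (D * (p * 18)) (y i j) (hy i j)) 0)) : (ChartRing (𝒜u i) (fun l => algebraMap (MvPolynomial (Fin 4) k) (Localization.Away (hh i)) (X ((![0, 1, 2] : Fin 3 → Fin 4) l))) ((![(![9, 2, 3] : Fin 3 → ℕ), (![3, 1, 2] : Fin 3 → ℕ)] : Fin 2 → (Fin 3 → ℕ)) i) (D * (p * 18)) (y i j) (hy i j))) = algebraMap _ (ChartRing (𝒜u i) (fun l => algebraMap (MvPolynomial (Fin 4) k) (Localization.Away (hh i)) (X ((![0, 1, 2] : Fin 3 → Fin 4) l))) ((![(![9, 2, 3] : Fin 3 → ℕ), (![3, 1, 2] : Fin 3 → ℕ)] : Fin 2 → (Fin 3 → ℕ)) i) (D * (p * 18)) (y i j) (hy i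 j)) ((coverElement (𝒜u i) (fun l => algebraMap (MvPolynomial (Fin 4) k) (Localization.Away (hh i)) (X ((![0, 1, 2] : Fin 3 → Fin 4) l))) ((![(![9, 2, 3] : Fin 3 → ℕ), (![3, 1, 2] : Fin 3 → ℕ)] : Fin 2 → (Fin 3 → ℕ)) i) (D * (p * 18))) (y i j') (hy i j')) * IsLocalization.Away.invSelf ((coverElement (𝒜u i) (fun l => algebraMap (MvPolynomial (Fin 4) k) (Localization.Away (hh i)) (X ((![0, 1, 2] : Fin 3 → Fin 4) l))) ((![(![9, 2, 3] : Fin 3 → ℕ), (![3, 1, 2] : Fin 3 → ℕ)] : Fin 2 → (Fin 3 → ℕ)) i) (D * (p * 18))) (y i j) (hy i j)) ∧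
        ∀ v ∈ (OW i j).1, v ∈ (OW i j').1 → v ∈ M₁.V.basicOpen t := by
    intro i j j'
    letI := chartNodeGradedRing ![] (𝒜u i) (fun l => algebraMap (MvPolynomial (Fin 4) k) (Localization.Away (hh i)) (X ((![0, 1, 2] : Fin 3 → Fin 4) l))) ((![(![9, 2, 3] : Fin 3 → ℕ), (![3, 1, 2] : Fin 3 → ℕ)] : Fin 2 → (Fin 3 → ℕ)) i) (hfA i) (D * (p * 18)) (y i j) (hy i j)
    have hmem := transitionSection_mem_chartNodeGrading_zero ![] (𝒜u i) (fun l => algebraMap (MvPolynomial (Fin 4) k) (Localization.Away (hh i)) (X ((![0, 1, 2] : Fin 3 → Fin 4) l))) ((![(![9, 2, 3] : Fin 3 → ℕ), (![3, 1, 2] : Fin 3 → ℕ)] : Fin 2 → (Fin 3 → ℕ)) i) (hfA i) (y i j) (hy i j) (y i j') (hy i j')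
    have hpz : (E i j).symm ⟨_, hmem⟩ * π₁.appLE (basicOpenStable (GModel.initial (p := p) (g₀ := g₀) hq h₀).act O hO (actO_symm_eq_of_fixed hG (GModel.initial (p := p) (g₀ := g₀) hq h₀) O (eI i) (σI i) (hactI i) (hh i) (hσh i))).1 (OW i j).1 (hWle₁ i j) ((eW i).symm (y i j)) = π₁.appLE (basicOpenStable (GModel.initial (p := p) (g₀ := g₀) hq h₀).act O hO (actO_symm_eq_of_fixed hG (GModel.initial (p := p) (g₀ := g₀) hq h₀) O (eI i) (σI i) (hactI i) (hh i) (hσh i))).1 (OW i j).1 (hWle₁ i j) ((eW i).symm (y i j')) :=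
      symm_mul_appLE_eq_of_pin π₁ (basicOpenStable (GModel.initial (p := p) (g₀ := g₀) hq h₀).act O hO (actO_symm_eq_of_fixed hG (GModel.initial (p := p) (g₀ := g₀) hq h₀) O (eI i) (σI i) (hactI i) (hh i) (hσh i))).1 (OW i j).1 (hWle₁ i j) (chartNodeGrading ![] (𝒜u i) (fun l => algebraMap (MvPolynomial (Fin 4) k) (Localization.Away (hh i)) (X ((![0, 1, 2] : Fin 3 → Fin 4) l))) ((![(![9, 2, 3] : Fin 3 → ℕ), (![3, 1, 2] : Fin 3 → ℕ)] : Fin 2 → (Fin 3 → ℕ)) i) (hfA i) (D * (p * 18)) (y i j) (hy i j)) (E i j) (eW i)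
        (toChartRing (𝒜u i) (fun l => algebraMap (MvPolynomial (Fin 4) k) (Localization.Away (hh i)) (X ((![0, 1, 2] : Fin 3 → Fin 4) l))) ((![(![9, 2, 3] : Fin 3 → ℕ), (![3, 1, 2] : Fin 3 → ℕ)] : Fin 2 → (Fin 3 → ℕ)) i) (D * (p * 18)) (y i j) (hy i j)) (hpin i j (hWle₁ i j)) ⟨_, hmem⟩ ((eW i).symm (y i j')) ((eW i).symm (y i j)) (y i j') (y i j)
        ((eW i).apply_symm_apply _) ((eW i).apply_symm_apply _) (coverElement_section_pin ![] (𝒜u i) (fun l => algebraMap (MvPolynomial (Fin 4) k) (Localization.Away (hh i)) (X ((![0, 1, 2] : Fin 3 → Fin 4) l))) ((![(![9, 2, 3] : Fin 3 → ℕ), (![3, 1, 2] : Fin 3 → ℕ)] : Fin 2 → (Fin 3 → ℕ)) i) (y i j) (hy i j) (y i j') (hy i j'))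
    refine ⟨(E i j).symm ⟨_, hmem⟩, by rw [(E i j).apply_symm_apply], fun v hvW hv' => ?_⟩
    exact mem_basicOpen_of_mem_blowupChart_of_mul_appLE_eq hπ' ⟨(basicOpenStable (GModel.initial (p := p) (g₀ := g₀) hq h₀).act O hO (actO_symm_eq_of_fixed hG (GModel.initial (p := p) (g₀ := g₀) hq h₀) O (eI i) (σI i) (hactI i) (hh i) (hσh i))).1, hWaff i⟩ (hxJ i j) (le_of_eq (hOWeq i j)) _ hpz hvW
      ((congrArg (fun U : M₁.V.Opens => v ∈ U) (hOWeq i j')).mp hv')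
  choose tr htrE htrU using htrans
  -- ### MOVE 2: the global sections `x₀`, `ξ_O = 2x₂ − 3x₁²`, `f = x₂² − x₁³` and their pull-backs to the producer charts `O′ᵢⱼ`
  have hγ0 : ∀ i, γ i (X 0) = X 0 := fun i => (hrest i).2.1.1
  have hγ1 : ∀ i, γ i (X 1) = X 1 + C ((![(0 : k), a] : Fin 2 → k) i) := fun i => (hrest i).2.1.2.1
  have hγ2 : ∀ i, γ i (X 2) = (![(X 2 : MvPolynomial (Fin 4) k), (X 2 + X 1 + C c : MvPolynomial (Fin 4) k)] : Fin 2 → (MvPolynomial (Fin 4) k)) i := fun i => (hrest i).2.1.2.2.1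
  have hO1 : ∀ i j, (OW i j).1 ≤ π₁ ⁻¹ᵁ O.1 := fun i j x _ => Set.mem_univ _
  obtain ⟨ξO, hξO⟩ : ∃ ξO : (MvPolynomial (Fin 4) k), ξO = 2 * X 2 - 3 * X 1 ^ 2 := ⟨_, rfl⟩
  obtain ⟨fO, hfO⟩ : ∃ fO : (MvPolynomial (Fin 4) k), fO = X 2 ^ 2 - X 1 ^ 3 := ⟨_, rfl⟩
  have hQ1' : (2 : MvPolynomial (Fin 4) k) * C c = 3 * C a ^ 2 := by
    rw [← map_ofNat (C : k →+* MvPolynomial (Fin 4) k) 2, ← map_ofNat (C : k →+* MvPolynomial (Fin 4) k) 3, ← map_pow, ← map_mul, ← map_mul, hQ1]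
  have hQ2' : (C c : MvPolynomial (Fin 4) k) ^ 2 = C a ^ 3 := by rw [← map_pow, ← map_pow, hQ2]
  have hγξ : ∀ i, γ i ξO = ((![(2 * X 2 - 3 * X 1 ^ 2 : MvPolynomial (Fin 4) k), (2 * X 2 + C (2 * (1 - 3 * a)) * X 1 - 3 * X 1 ^ 2 : MvPolynomial (Fin 4) k)] : Fin 2 → (MvPolynomial (Fin 4) k)) i) := by
    intro i
    rw [hξO, map_sub, map_mul, map_mul, map_pow, hγ1, hγ2, map_ofNat, map_ofNat]
    fin_cases i
    · simp only [Fin.zero_eta, Fin.isValue, Matrix.cons_val_zero, map_zero, add_zero]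
    · simp only [Fin.mk_one, Fin.isValue, Matrix.cons_val_one, Matrix.cons_val_zero, map_mul, map_sub, map_one, map_ofNat]
      linear_combination hQ1'
  have hγf : ∀ i, γ i fO = ((![(X 2 ^ 2 - X 1 ^ 3 : MvPolynomial (Fin 4) k), (X 2 ^ 2 + 2 * X 1 * X 2 + C (2 * c) * X 2 + C (1 - 3 * a) * X 1 ^ 2 - X 1 ^ 3 : MvPolynomial (Fin 4) k)] : Fin 2 → (MvPolynomial (Fin 4) k)) i) := by
    intro i
    rw [hfO, map_sub, map_pow, map_pow, hγ1, hγ2]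
    fin_cases i
    · simp only [Fin.zero_eta, Fin.isValue, Matrix.cons_val_zero, map_zero, add_zero]
    · simp only [Fin.mk_one, Fin.isValue, Matrix.cons_val_one, Matrix.cons_val_zero, map_mul, map_sub, map_one, map_ofNat]
      linear_combination hQ2' + X 1 * hQ1'
  -- restriction `Γ(O) → Γ(Wᵢ)`; pulling back through `Wᵢ` equals pulling back from `O`; `E`-values of pulled-back sections
  have hWO : ∀ i, (basicOpenStable (GModel.initial (p := p) (g₀ := g₀) hq h₀).act O hO (actO_symm_eq_of_fixed hG (GModel.initial (p := p) (g₀ := g₀) hq h₀) O (eI i) (σI i) (hactI i) (hh i) (hσh i))).1 ≤ O.1 := fun i => (GModel.initial (p := p) (g₀ := g₀) hq h₀).V.basicOpen_le _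
  obtain ⟨sW, hsW⟩ : ∃ sW : ∀ i, Γ((GModel.initial (p := p) (g₀ := g₀) hq h₀).V, O.1) →+* Γ((GModel.initial (p := p) (g₀ := g₀) hq h₀).V, (basicOpenStable (GModel.initial (p := p) (g₀ := g₀) hq h₀).act O hO (actO_symm_eq_of_fixed hG (GModel.initial (p := p) (g₀ := g₀) hq h₀) O (eI i) (σI i) (hactI i) (hh i) (hσh i))).1), sW = fun i => ((GModel.initial (p := p) (g₀ := g₀) hq h₀).V.presheaf.map (homOfLE (hWO i)).op).hom := ⟨_, rfl⟩
  have hpinW' : ∀ i (t : Γ((GModel.initial (p := p) (g₀ := g₀) hq h₀).V, O.1)), ((eW i (sW i t) : ↥(𝒜u i 0)) : (Localization.Away (hh i))) = algebraMap (MvPolynomial (Fin 4) k) (Localization.Away (hh i)) (eI i t) := fun i t => by rw [hsW]; exact hpinW i t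
  have hresW : ∀ i j (t : Γ((GModel.initial (p := p) (g₀ := g₀) hq h₀).V, O.1)), π₁.appLE (basicOpenStable (GModel.initial (p := p) (g₀ := g₀) hq h₀).act O hO (actO_symm_eq_of_fixed hG (GModel.initial (p := p) (g₀ := g₀) hq h₀) O (eI i) (σI i) (hactI i) (hh i) (hσh i))).1 (OW i j).1 (hWle₁ i j) (sW i t) = π₁.appLE O.1 (OW i j).1 (hO1 i j) t := fun i j t => by
    rw [hsW]; exact Scheme.Hom.map_appLE_apply π₁ (hWle₁ i j) (hWO i) (hO1 i j) t
  have hEval : ∀ i j (t : Γ((GModel.initial (p := p) (g₀ := g₀) hq h₀).V, O.1)), letI := chartNodeGradedRing ![] (𝒜u i) (fun l => algebraMap (MvPolynomial (Fin 4) k) (Localization.Away (hh i)) (X ((![0, 1, 2] : Fin 3 → Fin 4) l))) ((![(![9, 2, 3] : Fin 3 → ℕ), (![3, 1, 2] : Fin 3 → ℕ)] : Fin 2 → (Fin 3 → ℕ)) i) (hfA i) (D * (p * 18)) (y i j) (hy i j)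
      ((E i j (π₁.appLE O.1 (OW i j).1 (hO1 i j) t) : ↥((chartNodeGrading ![] (𝒜u i) (fun l => algebraMap (MvPolynomial (Fin 4) k) (Localization.Away (hh i)) (X ((![0, 1, 2] : Fin 3 → Fin 4) l))) ((![(![9, 2, 3] : Fin 3 → ℕ), (![3, 1, 2] : Fin 3 → ℕ)] : Fin 2 → (Fin 3 → ℕ)) i) (hfA i) (D * (p * 18)) (y i j) (hy i j)) 0)) : (ChartRing (𝒜u i) (fun l => algebraMap (MvPolynomial (Fin 4) k) (Localization.Away (hh i)) (X ((![0, 1, 2] : Fin 3 → Fin 4) l))) ((![(![9, 2, 3] : Fin 3 → ℕ), (![3, 1, 2] : Fin 3 → ℕ)] : Fin 2 → (Fin 3 → ℕ)) i) (D * (p * 18)) (y i j) (hy i j))) = algebraMap ↥(cobordantAlgebra (fun l => algebraMap (MvPolynomial (Fin 4) k) (Localization.Away (hh i)) (X ((![0, 1, 2] : Fin 3 → Fin 4) l))) ((![(![9, 2, 3] : Fin 3 → ℕ), (![3, 1, 2] : Fin 3 → ℕ)] : Fin 2 → (Fin 3 → ℕ)) i)) (ChartRing (𝒜u i) (fun l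 => algebraMap (MvPolynomial (Fin 4) k) (Localization.Away (hh i)) (X ((![0, 1, 2] : Fin 3 → Fin 4) l))) ((![(![9, 2, 3] : Fin 3 → ℕ), (![3, 1, 2] : Fin 3 → ℕ)] : Fin 2 → (Fin 3 → ℕ)) i) (D * (p * 18)) (y i j) (hy i j)) (algebraMap (Localization.Away (hh i)) ↥(cobordantAlgebra (fun l => algebraMap (MvPolynomial (Fin 4) k) (Localization.Away (hh i)) (X ((![0, 1, 2] : Fin 3 → Fin 4) l))) ((![(![9, 2, 3] : Fin 3 → ℕ), (![3, 1, 2] : Fin 3 → ℕ)] : Fin 2 → (Fin 3 → ℕ)) i)) (algebraMap (MvPolynomial (Fin 4) k) (Localization.Away (hh i)) (eI i t))) := by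
    intro i j t
    letI := chartNodeGradedRing ![] (𝒜u i) (fun l => algebraMap (MvPolynomial (Fin 4) k) (Localization.Away (hh i)) (X ((![0, 1, 2] : Fin 3 → Fin 4) l))) ((![(![9, 2, 3] : Fin 3 → ℕ), (![3, 1, 2] : Fin 3 → ℕ)] : Fin 2 → (Fin 3 → ℕ)) i) (hfA i) (D * (p * 18)) (y i j) (hy i j)
    rw [← hresW, hpin i j (hWle₁ i j), toChartRing_apply]
    congr 2
    exact hpinW' i t
  have htop : (⊤ : M₁.V.Opens) ≤ π₁ ⁻¹ᵁ O.1 := fun _ _ => Set.mem_univ _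
  have happ : ∀ i j (x : Γ((GModel.initial (p := p) (g₀ := g₀) hq h₀).V, O.1)), (M₁.V.presheaf.map (homOfLE (le_top : (OW i j).1 ≤ ⊤)).op).hom (π₁.appLE O.1 ⊤ htop x) = π₁.appLE O.1 (OW i j).1 (hO1 i j) x :=
    fun i j x => Scheme.Hom.appLE_map_apply π₁ htop (le_top : (OW i j).1 ≤ ⊤) x
  obtain ⟨r0, hr0d⟩ : ∃ r0 : ∀ i j, Γ(M₁.V, (OW i j).1), r0 = fun i j => π₁.appLE O.1 (OW i j).1 (hO1 i j) (e₀.symm (X 0)) := ⟨_, rfl⟩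
  obtain ⟨rxi, hrxid⟩ : ∃ rxi : ∀ i j, Γ(M₁.V, (OW i j).1), rxi = fun i j => π₁.appLE O.1 (OW i j).1 (hO1 i j) (e₀.symm ξO) := ⟨_, rfl⟩
  obtain ⟨rt, hrtd⟩ : ∃ rt : ∀ i j, Γ(M₁.V, (OW i j).1), rt = fun i j => π₁.appLE O.1 (OW i j).1 (hO1 i j) (e₀.symm fO) := ⟨_, rfl⟩
  have hr0 : ∀ i j, letI := chartNodeGradedRing ![] (𝒜u i) (fun l => algebraMap (MvPolynomial (Fin 4) k) (Localization.Away (hh i)) (X ((![0, 1, 2] : Fin 3 → Fin 4) l))) ((![(![9, 2, 3] : Fin 3 → ℕ), (![3, 1, 2] : Fin 3 → ℕ)] : Fin 2 → (Fin 3 → ℕ)) i) (hfA i) (D * (p * 18)) (y i j) (hy i j)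
      ((E i j (r0 i j) : ↥((chartNodeGrading ![] (𝒜u i) (fun l => algebraMap (MvPolynomial (Fin 4) k) (Localization.Away (hh i)) (X ((![0, 1, 2] : Fin 3 → Fin 4) l))) ((![(![9, 2, 3] : Fin 3 → ℕ), (![3, 1, 2] : Fin 3 → ℕ)] : Fin 2 → (Fin 3 → ℕ)) i) (hfA i) (D * (p * 18)) (y i j) (hy i j)) 0)) : (ChartRing (𝒜u i) (fun l => algebraMap (MvPolynomial (Fin 4) k) (Localization.Away (hh i)) (X ((![0, 1, 2] : Fin 3 → Fin 4) l))) ((![(![9, 2, 3] : Fin 3 → ℕ), (![3, 1, 2] : Fin 3 → ℕ)] : Fin 2 → (Fin 3 → ℕ)) i) (D * (p * 18)) (y i j) (hy i j))) = algebraMap ↥(cobordantAlgebra (fun l => algebraMap (MvPolynomial (Fin 4) k) (Localization.Away (hh i)) (X ((![0, 1, 2] : Fin 3 → Fin 4) l))) ((![(![9, 2, 3] : Fin 3 → ℕ), (![3, 1, 2] : Fin 3 → ℕ)] : Fin 2 → (Fin 3 → ℕ)) i)) (ChartRing (𝒜u i) (fun l => algebraMap (MvPolynomial (Fin 4) k)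 (Localization.Away (hh i)) (X ((![0, 1, 2] : Fin 3 → Fin 4) l))) ((![(![9, 2, 3] : Fin 3 → ℕ), (![3, 1, 2] : Fin 3 → ℕ)] : Fin 2 → (Fin 3 → ℕ)) i) (D * (p * 18)) (y i j) (hy i j)) (algebraMap (Localization.Away (hh i)) ↥(cobordantAlgebra (fun l => algebraMap (MvPolynomial (Fin 4) k) (Localization.Away (hh i)) (X ((![0, 1, 2] : Fin 3 → Fin 4) l))) ((![(![9, 2, 3] : Fin 3 → ℕ), (![3, 1, 2] : Fin 3 → ℕ)] : Fin 2 → (Fin 3 → ℕ)) i)) ((fun l => algebraMap (MvPolynomial (Fin 4) k) (Localization.Away (hh i)) (X ((![0, 1, 2] : Fin 3 → Fin 4) l))) 0)) := fun i j => by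
    rw [hr0d, hEval i j, heI, e₀.apply_symm_apply, hγ0]
    rfl
  have hrxi : ∀ i j, letI := chartNodeGradedRing ![] (𝒜u i) (fun l => algebraMap (MvPolynomial (Fin 4) k) (Localization.Away (hh i)) (X ((![0, 1, 2] : Fin 3 → Fin 4) l))) ((![(![9, 2, 3] : Fin 3 → ℕ), (![3, 1, 2] : Fin 3 → ℕ)] : Fin 2 → (Fin 3 → ℕ)) i) (hfA i) (D * (p * 18)) (y i j) (hy i j)
      ((E i j (rxi i j) : ↥((chartNodeGrading ![] (𝒜u i) (fun l => algebraMap (MvPolynomial (Fin 4) k) (Localization.Away (hh i)) (X ((![0, 1, 2] : Fin 3 → Fin 4) l))) ((![(![9, 2, 3] : Fin 3 → ℕ), (![3, 1, 2] : Fin 3 → ℕ)] : Fin 2 → (Fin 3 → ℕ)) i) (hfA i) (D * (p * 18)) (y i j) (hy i j)) 0)) : (ChartRing (𝒜u i) (fun l => algebraMap (MvPolynomial (Fin 4) k) (Localization.Away (hh i)) (X ((![0, 1, 2] : Fin 3 → Fin 4) l))) ((![(![9, 2, 3] : Fin 3 → ℕ), (![3, 1, 2] : Fin 3 → ℕ)]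 : Fin 2 → (Fin 3 → ℕ)) i) (D * (p * 18)) (y i j) (hy i j))) = algebraMap ↥(cobordantAlgebra (fun l => algebraMap (MvPolynomial (Fin 4) k) (Localization.Away (hh i)) (X ((![0, 1, 2] : Fin 3 → Fin 4) l))) ((![(![9, 2, 3] : Fin 3 → ℕ), (![3, 1, 2] : Fin 3 → ℕ)] : Fin 2 → (Fin 3 → ℕ)) i)) (ChartRing (𝒜u i) (fun l => algebraMap (MvPolynomial (Fin 4) k) (Localization.Away (hh i)) (X ((![0, 1, 2] : Fin 3 → Fin 4) l))) ((![(![9, 2, 3] : Fin 3 → ℕ), (![3, 1, 2] : Fin 3 → ℕ)] : Fin 2 → (Fin 3 → ℕ)) i) (D * (p * 18)) (y i j) (hy i j)) (algebraMap (Localization.Away (hh i)) ↥(cobordantAlgebra (fun l => algebraMap (MvPolynomial (Fin 4) k) (Localization.Away (hh i)) (X ((![0, 1, 2] : Fin 3 → Fin 4) l))) ((![(![9, 2, 3] : Fin 3 → ℕ), (![3, 1, 2] : Fin 3 → ℕ)] : Fin 2 → (Fin 3 → ℕ)) i)) (algebraMap (MvPolynomial (Fin 4) k) (Localization.Away (hh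 i)) ((![(2 * X 2 - 3 * X 1 ^ 2 : MvPolynomial (Fin 4) k), (2 * X 2 + C (2 * (1 - 3 * a)) * X 1 - 3 * X 1 ^ 2 : MvPolynomial (Fin 4) k)] : Fin 2 → (MvPolynomial (Fin 4) k)) i))) := fun i j => by
    rw [hrxid, hEval i j, heI, e₀.apply_symm_apply, hγξ]
  have hrt : ∀ i j, letI := chartNodeGradedRing ![] (𝒜u i) (fun l => algebraMap (MvPolynomial (Fin 4) k) (Localization.Away (hh i)) (X ((![0, 1, 2] : Fin 3 → Fin 4) l))) ((![(![9, 2, 3] : Fin 3 → ℕ), (![3, 1, 2] : Fin 3 → ℕ)] : Fin 2 → (Fin 3 → ℕ)) i) (hfA i) (D * (p * 18)) (y i j) (hy i j)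
      ((E i j (rt i j) : ↥((chartNodeGrading ![] (𝒜u i) (fun l => algebraMap (MvPolynomial (Fin 4) k) (Localization.Away (hh i)) (X ((![0, 1, 2] : Fin 3 → Fin 4) l))) ((![(![9, 2, 3] : Fin 3 → ℕ), (![3, 1, 2] : Fin 3 → ℕ)] : Fin 2 → (Fin 3 → ℕ)) i) (hfA i) (D * (p * 18)) (y i j) (hy i j)) 0)) : (ChartRing (𝒜u i) (fun l => algebraMap (MvPolynomial (Fin 4) k) (Localization.Away (hh i)) (X ((![0, 1, 2] : Fin 3 → Fin 4) l))) ((![(![9, 2, 3] : Fin 3 → ℕ), (![3, 1, 2] : Fin 3 → ℕ)] : Fin 2 → (Fin 3 → ℕ)) i) (D * (p * 18)) (y i j) (hy i j))) = algebraMap ↥(cobordantAlgebra (fun l => algebraMap (MvPolynomial (Fin 4) k) (Localization.Away (hh i)) (X ((![0, 1, 2] : Fin 3 → Fin 4) l))) ((![(![9, 2, 3] : Fin 3 → ℕ), (![3, 1, 2] : Fin 3 → ℕ)] : Fin 2 → (Fin 3 → ℕ)) i)) (ChartRing (𝒜u i) (fun l => algebraMap (MvPolynomial (Fin 4) k) (Localization.Away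 (hh i)) (X ((![0, 1, 2] : Fin 3 → Fin 4) l))) ((![(![9, 2, 3] : Fin 3 → ℕ), (![3, 1, 2] : Fin 3 → ℕ)] : Fin 2 → (Fin 3 → ℕ)) i) (D * (p * 18)) (y i j) (hy i j)) (algebraMap (Localization.Away (hh i)) ↥(cobordantAlgebra (fun l => algebraMap (MvPolynomial (Fin 4) k) (Localization.Away (hh i)) (X ((![0, 1, 2] : Fin 3 → Fin 4) l))) ((![(![9, 2, 3] : Fin 3 → ℕ), (![3, 1, 2] : Fin 3 → ℕ)] : Fin 2 → (Fin 3 → ℕ)) i)) (algebraMap (MvPolynomial (Fin 4) k) (Localization.Away (hh i)) ((![(X 2 ^ 2 - X 1 ^ 3 : MvPolynomial (Fin 4) k), (X 2 ^ 2 + 2 * X 1 * X 2 + C (2 * c) * X 2 + C (1 - 3 * a) * X 1 ^ 2 - X 1 ^ 3 : MvPolynomial (Fin 4) k)] : Fin 2 → (MvPolynomial (Fin 4) k)) i))) := fun i j => by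
    rw [hrtd, hEval i j, heI, e₀.apply_symm_apply, hγf]
  -- ### the three members: `U_O ⊆ O′₀₁` (✓OXi), `U_{Q,1} ⊆ O′₁₁` (✓Q), `U_{Q,2} ⊆ O′₁₂` (✓Qv)
  have hhhO : hh 0 = ∏ l : ZMod p, (X 1 + C (-a) + (l.val : (MvPolynomial (Fin 4) k)) * X 0) := by
    rw [hhh 0, show Finset.univ.erase (0 : Fin 2) = {1} from by decide, Finset.prod_singleton]
    simp only [Fin.isValue, Matrix.cons_val_zero, Matrix.cons_val_one, zero_sub]
  have hhhQ : hh 1 = ∏ l : ZMod p, (X 1 + C a + (l.val : (MvPolynomial (Fin 4) k)) * X 0) := by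
    rw [hhh 1, show Finset.univ.erase (1 : Fin 2) = {0} from by decide, Finset.prod_singleton]
    simp only [Fin.isValue, Matrix.cons_val_zero, Matrix.cons_val_one, sub_zero]
  have hDBpos : 0 < (D * (p * 18)) := Nat.mul_pos hD hkk
  have hmemO := exists_cuspO_memberChart_rel_xi (p := p) hG (σI 0) (hCI 0) (h0I 0) (h1I 0) (h2I 0) (h3I 0) a ha hk2 (hh 0) hhhO (hσh 0) hp.pos (hσpL 0) (hσJ 0) (ht 0)
    ![] (𝒜u 0) (hfull 0) (hfA 0) (y 0 1) (hy 0 1) (hσy 0 1) (hcov1 0) hDBpos M₁ (OW 0 1) (hOWaff 0 1) (E 0 1) (htame' 0 1) (hE' 0 1) (r0 0 1) (rxi 0 1) (rt 0 1) (hr0 0 1) (hrxi 0 1) (hrt 0 1)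
  obtain ⟨bO, UO, hUOW, hUOb, hbO, aO, bbO, hrelaO, hrelbO, dO, hdOpos, hKO⟩ := hmemO
  have hmemQ := exists_cuspQ_memberChart_rel (p := p) hG (σI 1) (hCI 1) a c ha hc0 hQ1 hQ2 hk2 he0 (h0I 1) (h1I 1) (h2I 1) (h3I 1) (hh 1) hhhQ (hσh 1) hp.pos (hσpL 1) (hσJ 1) (ht 1)
    ![] (𝒜u 1) (hfull 1) (hfA 1) (y 1 1) (hy 1 1) (hσy 1 1) (hcov1 1) hDBpos M₁ (OW 1 1) (hOWaff 1 1) (E 1 1) (htame' 1 1) (hE' 1 1) (r0 1 1) (rxi 1 1) (rt 1 1) (hr0 1 1) (hrxi 1 1) (hrt 1 1)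
  obtain ⟨bQ, UQ, hUQW, hUQb, hbQ, aQ, bbQ, hrelaQ, hrelbQ, dQ, hdQpos, hKQ⟩ := hmemQ
  have hc1v : ((coverElement (𝒜u 1) (fun l => algebraMap (MvPolynomial (Fin 4) k) (Localization.Away (hh 1)) (X ((![0, 1, 2] : Fin 3 → Fin 4) l))) ((![(![9, 2, 3] : Fin 3 → ℕ), (![3, 1, 2] : Fin 3 → ℕ)] : Fin 2 → (Fin 3 → ℕ)) 1) (D * (p * 18))) (y 1 2) (hy 1 2)) = cobordantAlgebra.u' (fun l => algebraMap (MvPolynomial (Fin 4) k) (Localization.Away (hh 1)) (X ((![0, 1, 2] : Fin 3 → Fin 4) l))) ((![(![9, 2, 3] : Fin 3 → ℕ), (![3, 1, 2] : Fin 3 → ℕ)] : Fin 2 → (Fin 3 → ℕ)) 1) 2 ^ (p * ((![6 * D, 9 * D] : Fin 2 → ℕ) 1)) := by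
    have h12 := hcov2 1
    rw [show ((![1, 0] : Fin 2 → ℕ) 1) = 0 from rfl, Nat.cast_zero] at h12
    simp only [zero_mul, map_zero, add_zero, Finset.prod_const, Finset.card_univ, ZMod.card, ← pow_mul] at h12
    exact h12
  have hmemQv := exists_cuspQv_memberChart_rel (p := p) hG (σI 1) (hCI 1) a c ha hc0 hQ1 hQ2 hk2 he0 (h0I 1) (h1I 1) (h2I 1) (h3I 1) (hh 1) hhhQ (hσh 1) hp.pos (hσpL 1) (hσJ 1) (ht 1)
    ![] (𝒜u 1) (hfull 1) (hfA 1) (y 1 2) (hy 1 2) (hσy 1 2) hc1v hDBpos M₁ (OW 1 2) (hOWaff 1 2) (E 1 2) (htame' 1 2) (hE' 1 2) (r0 1 2) (rxi 1 2) (rt 1 2) (hr0 1 2) (hrxi 1 2) (hrt 1 2)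
  obtain ⟨bQv, UQv, hUQvW, hUQvb, hbQv, aQv, bbQv, hrelaQv, hrelbQv, dQv, hdQvpos, hKQv⟩ := hmemQv
  -- ### MOVE 2 remaining: common degree, `hass` by ✓`associated_sections_of_mul_pow_eq_global`, kill by ✓`killsIn_one_of_sectionCharts_of_associated` (cover / units / F-locus obligations) — see `CuspKillsIn.src.lean`
  sorry

end Summit.ResolutionOfSingularities.ResolutionOfSingularities.Cruxes.CyclicQuotientFourfolds.CuspKillsInSkeleton

end
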